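import Summits.Ventures.PercRepro2.CaseOneRootLeafAtA3
import Summits.Ventures.PercRepro2.CaseOneMarkMoves

/-!
# The root `a₂` pendant at the statement vertex: every such instance is closed
(blind cell PercRepro2, p1 g29; the twin of `CaseOneRootLeafAtA3`)

Let `a₂` be a leaf at `a₃` through `e₀` of weight `q` (`a₁, o, b ≠ a₂`). Under `Q = {a₁ ↮ a₂}` the
cluster `C₂` is `{a₂}` when `e₀` is closed and `{a₂} ∪ C(a₃)` when it is open — but then `a₃ ∉ C₁`,
so every mass carrying both `a₃ ∈ C₁` and a `C₂`-event vanishes (`QAO_rootLeafB_empty`,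
`QBA_rootLeafB_empty`, `QBAO_rootLeafB_empty`, `QB1AO_rootLeafB_empty`), and the forms collapse to
`(ii-t) = c₀ · P(Q, b ∈ C₂) · P(Q, a₃ ∈ C₁) ≥ 0` and `(i-t) = c₀ (1 − q) · [P′(a₁ ↔ b, a₁ ↔ a₃) −
P′(a₁ ↔ b) P′(a₁ ↔ a₃)] ≥ 0` (Harris in `G − e₀`), for every pair with `c₀ ≥ 0`:
**`closedAt_of_a2_leaf_at_a3`**. With `closedAt_of_a1_leaf_at_a3`: A ROOT PENDANT AT THE STATEMENT
VERTEX IS CLOSED. Own code; standard axioms.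
-/

namespace Summit.Ventures.PercRepro2

namespace CaseOne

section RootLeafB
variable {V : Type*} {E : Type*} [Fintype E] [DecidableEq E] {R : Type*} [CommRing R]
variable {ends : E → Sym2 V} {o a₁ a₂ a₃ b : V} {e₀ : E}

omit [Fintype E] [DecidableEq E] in
/-- `a₂ ↔ x ⟺ e₀ open ∧ a₃ ↔ x` for `x ≠ a₂`. -/
lemma conn_a2_rootLeafB (hl : IsLeafAt ends a₃ a₂ e₀) {x : V} (hx : x ≠ a₂) (ω : Config E) :
    Conn ends ω a₂ x ↔ ω e₀ = true ∧ Conn ends ω a₃ x := by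
  constructor
  · intro h
    obtain ⟨he, hc⟩ := (conn_leaf_at_iff hl ω hx).1 (conn_symm h)
    exact ⟨he, conn_symm hc⟩
  · rintro ⟨he, hc⟩
    exact conn_symm ((conn_leaf_at_iff hl ω hx).2 ⟨he, conn_symm hc⟩)

omit [Fintype E] [DecidableEq E] in
/-- `a₁ ↔ a₂ ⟺ e₀ open ∧ a₁ ↔ a₃`. -/
lemma conn_a1_a2_rootLeafB (hl : IsLeafAt ends a₃ a₂ e₀) (h1 : a₁ ≠ a₂) (ω : Config E) :
    Conn ends ω a₁ a₂ ↔ ω e₀ = true ∧ Conn ends ω a₁ a₃ :=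
  conn_leaf_at_iff hl ω h1

omit [Fintype E] [DecidableEq E] in
/-- `{a₃ ∈ C₁} ∩ {o ∈ C₂} ∩ Q = ∅`. -/
lemma QAO_rootLeafB_empty (hl : IsLeafAt ends a₃ a₂ e₀) (h1 : a₁ ≠ a₂) (ho : o ≠ a₂) :
    connEvent ends a₁ a₃ ∩ connEvent ends a₂ o ∩ (connEvent ends a₁ a₂)ᶜ = ∅ := by
  ext ω
  simp only [Set.mem_inter_iff, Set.mem_compl_iff, mem_connEvent, Set.mem_empty_iff_false,
    iff_false, not_and, not_not]
  intro h
  rw [conn_a1_a2_rootLeafB hl h1 ω]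
  exact ⟨((conn_a2_rootLeafB hl ho ω).1 h.2).1, h.1⟩

omit [Fintype E] [DecidableEq E] in
/-- `{b ∈ C₂} ∩ {a₃ ∈ C₁} ∩ Q = ∅`. -/
lemma QBA_rootLeafB_empty (hl : IsLeafAt ends a₃ a₂ e₀) (h1 : a₁ ≠ a₂) (hb : b ≠ a₂) :
    connEvent ends a₂ b ∩ connEvent ends a₁ a₃ ∩ (connEvent ends a₁ a₂)ᶜ = ∅ := by
  ext ω
  simp only [Set.mem_inter_iff, Set.mem_compl_iff, mem_connEvent, Set.mem_empty_iff_false,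
    iff_false, not_and, not_not]
  intro h
  rw [conn_a1_a2_rootLeafB hl h1 ω]
  exact ⟨((conn_a2_rootLeafB hl hb ω).1 h.1).1, h.2⟩

omit [Fintype E] [DecidableEq E] in
/-- `{b ∈ C₂} ∩ {a₃ ∈ C₁} ∩ {o ∈ C₂} ∩ Q = ∅`. -/
lemma QBAO_rootLeafB_empty (hl : IsLeafAt ends a₃ a₂ e₀) (h1 : a₁ ≠ a₂) (hb : b ≠ a₂) :
    connEvent ends a₂ b ∩ connEvent ends a₁ a₃ ∩ connEvent ends a₂ o ∩ (connEvent ends a₁ a₂)ᶜ =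
      ∅ := by
  ext ω
  simp only [Set.mem_inter_iff, Set.mem_compl_iff, mem_connEvent, Set.mem_empty_iff_false,
    iff_false, not_and, not_not]
  intro h
  rw [conn_a1_a2_rootLeafB hl h1 ω]
  exact ⟨((conn_a2_rootLeafB hl hb ω).1 h.1.1).1, h.1.2⟩

omit [Fintype E] [DecidableEq E] in
/-- `{b ∈ C₁} ∩ {a₃ ∈ C₁} ∩ {o ∈ C₂} ∩ Q = ∅`. -/
lemma QB1AO_rootLeafB_empty (hl : IsLeafAt ends a₃ a₂ e₀) (h1 : a₁ ≠ a₂) (ho : o ≠ a₂) :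
    connEvent ends a₁ b ∩ connEvent ends a₁ a₃ ∩ connEvent ends a₂ o ∩ (connEvent ends a₁ a₂)ᶜ =
      ∅ := by
  ext ω
  simp only [Set.mem_inter_iff, Set.mem_compl_iff, mem_connEvent, Set.mem_empty_iff_false,
    iff_false, not_and, not_not]
  intro h
  rw [conn_a1_a2_rootLeafB hl h1 ω]
  exact ⟨((conn_a2_rootLeafB hl ho ω).1 h.2).1, h.1.2⟩

variable (p : E → R) (hl : IsLeafAt ends a₃ a₂ e₀) (h1 : a₁ ≠ a₂)
include hl h1

/-- `P(Q) = (1 − q) + q P′(a₁ ↮ a₃)`. -/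
theorem probQ_rootLeafB :
    prob p (connEvent ends a₁ a₂)ᶜ = (1 - p e₀) +
      p e₀ * prob (restrictW p e₀) (connEvent (restrictEnds ends e₀) a₁ a₃)ᶜ := by
  rw [prob_split_edge p e₀ _ Set.univ (connEvent (restrictEnds ends e₀) a₁ a₃)ᶜ, prob_univ, mul_one]
  intro ω
  simp only [Set.mem_compl_iff, mem_connEvent, Set.mem_univ, and_true]
  rw [conn_a1_a2_rootLeafB hl h1 ω, conn_restrict_iff_of_leaf hl ω h1 hl.ne]
  cases h : ω e₀ <;> simp

/-- `P(Q, a₃ ∈ C₁) = (1 − q) P′(a₁ ↔ a₃)`. -/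
theorem probQA_rootLeafB :
    prob p (connEvent ends a₁ a₃ ∩ (connEvent ends a₁ a₂)ᶜ) =
      (1 - p e₀) * prob (restrictW p e₀) (connEvent (restrictEnds ends e₀) a₁ a₃) := by
  rw [prob_split_edge p e₀ _ (connEvent (restrictEnds ends e₀) a₁ a₃) ∅, prob_empty, mul_zero,
    add_zero]
  intro ω
  simp only [Set.mem_inter_iff, Set.mem_compl_iff, mem_connEvent, Set.mem_empty_iff_false, and_false,
    or_false]
  rw [conn_a1_a2_rootLeafB hl h1 ω, conn_restrict_iff_of_leaf hl ω h1 hl.ne]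
  cases h : ω e₀ <;> simp

include hl h1 in
/-- `P(Q, b ∈ C₁) = (1 − q) P′(a₁ ↔ b) + q P′(a₁ ↔ b, a₁ ↮ a₃)` (`b ≠ a₂`). -/
theorem probQB1_rootLeafB (hb : b ≠ a₂) :
    prob p (connEvent ends a₁ b ∩ (connEvent ends a₁ a₂)ᶜ) =
      (1 - p e₀) * prob (restrictW p e₀) (connEvent (restrictEnds ends e₀) a₁ b) +
      p e₀ * prob (restrictW p e₀) (connEvent (restrictEnds ends e₀) a₁ b ∩
        (connEvent (restrictEnds ends e₀) a₁ a₃)ᶜ) := by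
  rw [prob_split_edge p e₀ _ (connEvent (restrictEnds ends e₀) a₁ b)
    (connEvent (restrictEnds ends e₀) a₁ b ∩ (connEvent (restrictEnds ends e₀) a₁ a₃)ᶜ)]
  intro ω
  simp only [Set.mem_inter_iff, Set.mem_compl_iff, mem_connEvent]
  rw [conn_a1_a2_rootLeafB hl h1 ω, conn_restrict_iff_of_leaf hl ω h1 hl.ne,
    conn_restrict_iff_of_leaf hl ω h1 hb]
  cases h : ω e₀ <;> simp

/-- `P(Q, b ∈ C₁, a₃ ∈ C₁) = (1 − q) P′(a₁ ↔ b, a₁ ↔ a₃)` (`b ≠ a₂`). -/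
theorem probQB1A_rootLeafB (hb : b ≠ a₂) :
    prob p (connEvent ends a₁ b ∩ connEvent ends a₁ a₃ ∩ (connEvent ends a₁ a₂)ᶜ) =
      (1 - p e₀) * prob (restrictW p e₀) (connEvent (restrictEnds ends e₀) a₁ b ∩
        connEvent (restrictEnds ends e₀) a₁ a₃) := by
  rw [prob_split_edge p e₀ _ (connEvent (restrictEnds ends e₀) a₁ b ∩
    connEvent (restrictEnds ends e₀) a₁ a₃) ∅, prob_empty, mul_zero, add_zero]
  intro ω
  simp only [Set.mem_inter_iff, Set.mem_compl_iff, mem_connEvent, Set.mem_empty_iff_false, and_false,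
    or_false]
  rw [conn_a1_a2_rootLeafB hl h1 ω, conn_restrict_iff_of_leaf hl ω h1 hl.ne,
    conn_restrict_iff_of_leaf hl ω h1 hb]
  cases h : ω e₀ <;> simp

end RootLeafB

section FormsB
variable {V : Type*} {E : Type*} [Fintype E] [DecidableEq E]
  {R : Type*} [CommRing R] [LinearOrder R] [IsStrictOrderedRing R]
variable {ends : E → Sym2 V} {o a₁ a₂ a₃ b : V} {e₀ : E}
variable {p : E → R} (hp : IsProbVec p) (hl : IsLeafAt ends a₃ a₂ e₀) (h1 : a₁ ≠ a₂) (ho : o ≠ a₂)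
  (hb : b ≠ a₂)
include hp hl h1 ho hb

/-- `(ii-t)` for `a₂` pendant at `a₃`, at every pair with `c₀ ≥ 0`. -/
theorem iiExprT_nonneg_of_a2_leaf_at_a3 (c₀ c₁ : R) (hc₀ : 0 ≤ c₀) :
    0 ≤ iiExprT p ends o a₁ a₂ a₃ b c₀ c₁ := by
  rw [iiExprT_eq, QBAO_rootLeafB_empty hl h1 hb, QAO_rootLeafB_empty hl h1 ho,
    QBA_rootLeafB_empty hl h1 hb, prob_empty]
  have h := mul_nonneg hc₀ (mul_nonneg (prob_nonneg hp (connEvent ends a₂ b ∩ (connEvent ends a₁ a₂)ᶜ))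
    (prob_nonneg hp (connEvent ends a₁ a₃ ∩ (connEvent ends a₁ a₂)ᶜ)))
  linear_combination h

/-- `(i-t)` for `a₂` pendant at `a₃`, at every pair with `c₀ ≥ 0`: Harris in `G − e₀`. -/
theorem iExprT_nonneg_of_a2_leaf_at_a3 (c₀ c₁ : R) (hc₀ : 0 ≤ c₀) :
    0 ≤ iExprT p ends o a₁ a₂ a₃ b c₀ c₁ := by
  have hp' := IsProbVec.restrictW hp e₀
  rw [iExprT_eq, QB1AO_rootLeafB_empty hl h1 ho, QAO_rootLeafB_empty hl h1 ho, prob_empty,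
    probQ_rootLeafB p hl h1, probQB1_rootLeafB p hl h1 hb, probQB1A_rootLeafB p hl h1 hb,
    probQA_rootLeafB p hl h1]
  -- the masses of `G − e₀`: `P′(a₁ ↮ a₃) = 1 − α`, `P′(a₁ ↔ b, a₁ ↮ a₃) = β₁ − α₁`
  have hcompl := prob_compl (restrictW p e₀) (connEvent (restrictEnds ends e₀) a₁ a₃)
  have hsplit := prob_inter_add_prob_inter_compl (restrictW p e₀)
    (connEvent (restrictEnds ends e₀) a₁ b) (connEvent (restrictEnds ends e₀) a₁ a₃)
  have hharris := prob_mul_prob_le_prob_inter hp'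
    (isUpperSet_connEvent (restrictEnds ends e₀) a₁ b)
    (isUpperSet_connEvent (restrictEnds ends e₀) a₁ a₃)
  have hq1 := sub_nonneg.2 (hp.le_one e₀)
  rw [hcompl]
  have hy : prob (restrictW p e₀) (connEvent (restrictEnds ends e₀) a₁ b ∩
      (connEvent (restrictEnds ends e₀) a₁ a₃)ᶜ) =
      prob (restrictW p e₀) (connEvent (restrictEnds ends e₀) a₁ b) -
        prob (restrictW p e₀) (connEvent (restrictEnds ends e₀) a₁ b ∩
          connEvent (restrictEnds ends e₀) a₁ a₃) := by linear_combination hsplit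
  rw [hy]
  have key := mul_nonneg (mul_nonneg hc₀ hq1) (sub_nonneg.2 hharris)
  linear_combination key

/-- **The four forms for the root `a₂` pendant at the statement vertex.** -/
theorem fourForms_of_a2_leaf_at_a3 : FourForms p ends o a₁ a₂ a₃ b := by
  have hDo : 0 ≤ Dpdo p ends o a₁ a₂ a₃ := prob_nonneg hp _
  have hQo : 0 ≤ Dqo p ends o a₁ a₂ := prob_nonneg hp _
  refine ⟨?_, ?_, ?_, ?_⟩
  · rw [ZSplitII, iiExpr_eq_iiExprT]
    exact iiExprT_nonneg_of_a2_leaf_at_a3 hp hl h1 ho hb _ _ hDo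
  · exact iiExprT_nonneg_of_a2_leaf_at_a3 hp hl h1 ho hb _ _ hQo
  · rw [ZSplitI, iExpr_eq_iExprT]
    exact iExprT_nonneg_of_a2_leaf_at_a3 hp hl h1 ho hb _ _ hDo
  · exact iExprT_nonneg_of_a2_leaf_at_a3 hp hl h1 ho hb _ _ hQo

end FormsB

section ClosedB
universe u
variable {V : Type*} [Fintype V] [DecidableEq V] {R : Type*} [CommRing R] [LinearOrder R]
  [IsStrictOrderedRing R] {E : Type u} [Fintype E] [DecidableEq E] {ends : E → Sym2 V}
  {o a₁ a₂ a₃ b : V} {e₀ : E}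

omit [Fintype V] [DecidableEq V] in
/-- **The root `a₂` pendant at the statement vertex is closed** (`a₁, o, b ≠ a₂`). -/
theorem closedAt_of_a2_leaf_at_a3 (hl : IsLeafAt ends a₃ a₂ e₀) (h1 : a₁ ≠ a₂) (ho : o ≠ a₂)
    (hb : b ≠ a₂) : ClosedAt R o a₁ a₂ b E ends a₃ :=
  fun _ hp => fourForms_of_a2_leaf_at_a3 hp hl h1 ho hb

/-- **A root pendant at the statement vertex is closed**: either root, through a single leaf edge. -/
theorem closedAt_of_root_leaf_at_a3 {r : V} (hr : r = a₁ ∨ r = a₂) (hl : IsLeafAt ends a₃ r e₀)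
    (h1 : a₁ ≠ a₂) (ho : o ≠ r) (hb : b ≠ r) : ClosedAt R o a₁ a₂ b E ends a₃ := by
  rcases hr with rfl | rfl
  · exact closedAt_of_a1_leaf_at_a3 hl h1.symm ho hb
  · exact closedAt_of_a2_leaf_at_a3 hl h1 ho hb

variable {W : Set V} {P : Finset E}

/-- **The root `a₁` alone in a mark-free-otherwise pocket hanging at the statement vertex is closed**:
the pocket is a pendant root at `a₃`. -/
theorem closedAt_of_a1_pocket_at_a3 (h : IsPocket ends W a₃ P) (he : e₀ ∈ P) (h1 : a₁ ∈ W)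
    (ho : o ∉ W) (h2 : a₂ ∉ W) (hb : b ∉ W) : ClosedAt R o a₁ a₂ b E ends a₃ :=
  closedAt_of_pocket' (z := a₁) h he (Or.inl ho) (Or.inr rfl) (Or.inl h2) (Or.inl h.x_not_mem)
    (Or.inl hb)
    (closedAt_of_a1_leaf_at_a3 (h.isLeafAt_pocketEnds e₀ h1) (by rintro rfl; exact h2 h1)
      (by rintro rfl; exact ho h1) (by rintro rfl; exact hb h1))

omit [Fintype V] [DecidableEq V] in
/-- **The root `a₂` alone in a mark-free-otherwise pocket hanging at the statement vertex is closed.** -/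
theorem closedAt_of_a2_pocket_at_a3 (h : IsPocket ends W a₃ P) (he : e₀ ∈ P) (h2 : a₂ ∈ W)
    (ho : o ∉ W) (h1 : a₁ ∉ W) (hb : b ∉ W) : ClosedAt R o a₁ a₂ b E ends a₃ :=
  closedAt_of_pocket' (z := a₂) h he (Or.inl ho) (Or.inl h1) (Or.inr rfl) (Or.inl h.x_not_mem)
    (Or.inl hb)
    (closedAt_of_a2_leaf_at_a3 (h.isLeafAt_pocketEnds e₀ h2) (by rintro rfl; exact h1 h2)
      (by rintro rfl; exact ho h2) (by rintro rfl; exact hb h2))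

/-- **A root adjacent only to the statement vertex, through any number of edges, is closed**:
parallel edges merge (`ThickStep.par`) down to the pendant root. -/
theorem closedAt_of_a1_only_at_a3_aux (h2 : a₂ ≠ a₁) (ho : o ≠ a₁) (hb : b ≠ a₁) (h3 : a₃ ≠ a₁) :
    ∀ (n : ℕ) (E : Type u) [Fintype E] [DecidableEq E] (ends : E → Sym2 V) (e₀ : E),
      Fintype.card E = n → ends e₀ = s(a₃, a₁) → (∀ e, a₁ ∈ ends e → ends e = s(a₃, a₁)) →
      ClosedAt R o a₁ a₂ b E ends a₃ := by
  intro n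
  induction n using Nat.strong_induction_on with
  | _ n ih =>
    intro E _ _ ends e₀ hn he₀ hroot
    by_cases hpar : ∃ e₁, e₁ ≠ e₀ ∧ a₁ ∈ ends e₁
    · obtain ⟨e₁, hne, he₁⟩ := hpar
      have hlt : Fintype.card {e : E // e ≠ e₁} < n :=
        hn ▸ Fintype.card_subtype_lt (x := e₁) (by simp)
      refine closedAt_of_thickStep (ThickStep.par E ends e₀ e₁ (he₀.trans (hroot e₁ he₁).symm)
        hne.symm) ?_
      exact ih _ hlt {e : E // e ≠ e₁} (restrictEnds ends e₁) ⟨e₀, hne.symm⟩ rfl he₀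
        fun e he => hroot e.1 he
    · push Not at hpar
      exact closedAt_of_a1_leaf_at_a3 ⟨he₀, fun e he => (hpar e).mtr he, h3⟩ h2 ho hb

/-- **The root `a₁` adjacent only to the statement vertex (any multiplicity) is closed.** -/
theorem closedAt_of_a1_only_at_a3 (he₀ : ends e₀ = s(a₃, a₁))
    (hroot : ∀ e, a₁ ∈ ends e → ends e = s(a₃, a₁)) (h2 : a₂ ≠ a₁) (ho : o ≠ a₁) (hb : b ≠ a₁)
    (h3 : a₃ ≠ a₁) : ClosedAt R o a₁ a₂ b E ends a₃ :=
  closedAt_of_a1_only_at_a3_aux h2 ho hb h3 _ E ends e₀ rfl he₀ hroot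

end ClosedB

section RootAtRoot
variable {V : Type*} {E : Type*} [Fintype E] [DecidableEq E] {R : Type*} [CommRing R]
  [LinearOrder R] [IsStrictOrderedRing R]
variable {ends : E → Sym2 V} {o a₁ a₂ a₃ b : V} {e₀ : E}

omit [Fintype E] [DecidableEq E] [LinearOrder R] [IsStrictOrderedRing R] in
/-- For `a₁` a leaf at `a₂` (`a₃ ≠ a₁`) the event `{a₃ ∈ C₁} ∩ Q` is empty. -/
lemma QA_empty_of_a1_leaf_at_a2 (hl : IsLeafAt ends a₂ a₁ e₀) (h3 : a₃ ≠ a₁) (S : Set (Config E)) :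
    S ∩ connEvent ends a₁ a₃ ∩ (connEvent ends a₁ a₂)ᶜ = ∅ := by
  ext ω
  simp only [Set.mem_inter_iff, Set.mem_compl_iff, mem_connEvent, Set.mem_empty_iff_false,
    iff_false, not_and, not_not]
  intro h
  exact conn_symm ((conn_leaf_iff hl ω).2 ((conn_leaf_at_iff hl ω h3).1 (conn_symm h.2)).1)

omit [Fintype E] [DecidableEq E] [LinearOrder R] [IsStrictOrderedRing R] in
/-- `{a₃ ∈ C₁} ∩ Q = ∅` for `a₁` a leaf at `a₂`. -/
lemma QA_empty_of_a1_leaf_at_a2' (hl : IsLeafAt ends a₂ a₁ e₀) (h3 : a₃ ≠ a₁) :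
    connEvent ends a₁ a₃ ∩ (connEvent ends a₁ a₂)ᶜ = ∅ := by
  have := QA_empty_of_a1_leaf_at_a2 hl h3 (ends := ends) Set.univ
  rwa [Set.univ_inter] at this

omit [Fintype E] [DecidableEq E] [LinearOrder R] [IsStrictOrderedRing R] in
/-- `{a₃ ∈ C₁} ∩ S ∩ Q = ∅` for `a₁` a leaf at `a₂`. -/
lemma QA_empty_of_a1_leaf_at_a2'' (hl : IsLeafAt ends a₂ a₁ e₀) (h3 : a₃ ≠ a₁)
    (S : Set (Config E)) : connEvent ends a₁ a₃ ∩ S ∩ (connEvent ends a₁ a₂)ᶜ = ∅ := by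
  have := QA_empty_of_a1_leaf_at_a2 hl h3 (ends := ends) S
  rwa [Set.inter_comm S] at this

omit [Fintype E] [DecidableEq E] [LinearOrder R] [IsStrictOrderedRing R] in
/-- `S ∩ {a₃ ∈ C₁} ∩ T ∩ Q = ∅` for `a₁` a leaf at `a₂`. -/
lemma QA_empty_of_a1_leaf_at_a2₄ (hl : IsLeafAt ends a₂ a₁ e₀) (h3 : a₃ ≠ a₁)
    (S T : Set (Config E)) : S ∩ connEvent ends a₁ a₃ ∩ T ∩ (connEvent ends a₁ a₂)ᶜ = ∅ := by
  have := QA_empty_of_a1_leaf_at_a2 hl h3 (ends := ends) (S ∩ T)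
  rw [← this]
  ext ω; simp only [Set.mem_inter_iff]; tauto

omit [IsStrictOrderedRing R] in
/-- **The root `a₁` pendant at the root `a₂` is closed at every statement vertex `≠ a₁`**: under
`Q` the leaf edge is closed, `C₁ = {a₁}`, and every `A`-mass vanishes. -/
theorem closedAt_of_a1_leaf_at_a2 (hl : IsLeafAt ends a₂ a₁ e₀) (h3 : a₃ ≠ a₁) :
    ClosedAt R o a₁ a₂ b E ends a₃ := by
  intro p _
  have e1 := QA_empty_of_a1_leaf_at_a2 hl h3 (ends := ends)
  have e2 := QA_empty_of_a1_leaf_at_a2' hl h3 (ends := ends)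
  have e3 := QA_empty_of_a1_leaf_at_a2'' hl h3 (ends := ends)
  have e4 := QA_empty_of_a1_leaf_at_a2₄ hl h3 (ends := ends)
  refine ⟨?_, ?_, ?_, ?_⟩
  · rw [ZSplitII, iiExpr_eq_iiExprT, iiExprT_eq, e4, e3, e1, e2, prob_empty]; ring_nf; exact le_rfl
  · rw [ZSplitIIQ, iiExprT_eq, e4, e3, e1, e2, prob_empty]; ring_nf; exact le_rfl
  · rw [ZSplitI, iExpr_eq_iExprT, iExprT_eq, e4, e3, e1, e2, prob_empty]; ring_nf; exact le_rfl
  · rw [ZSplitIQ, iExprT_eq, e4, e3, e1, e2, prob_empty]; ring_nf; exact le_rfl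

end RootAtRoot

section PendantSpecial
universe u
variable {V : Type*} [Fintype V] [DecidableEq V] {R : Type*} [Field R] [LinearOrder R]
  [IsStrictOrderedRing R] {E : Type u} [Fintype E] [DecidableEq E] {ends : E → Sym2 V}
  {o a₁ a₂ a₃ b : V} {e₀ : E}

/-- The mark `o` pendant at the statement vertex closes it (the mark moves onto `a₃`). -/
theorem closedAt_of_o_leaf_at_a3 (hl : IsLeafAt ends a₃ o e₀) (h1 : a₁ ≠ o) (h2 : a₂ ≠ o)
    (hb : b ≠ o) : ClosedAt R o a₁ a₂ b E ends a₃ :=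
  closedAt_of_o_move hl h1 h2 hl.ne hb
    (fun p hp => fourForms_of_markAnchor a₃ a₁ a₂ b _ _ p hp a₃ (Or.inl rfl))

/-- The mark `b` pendant at the statement vertex closes it. -/
theorem closedAt_of_b_leaf_at_a3 (hl : IsLeafAt ends a₃ b e₀) (ho : o ≠ b) (h1 : a₁ ≠ b)
    (h2 : a₂ ≠ b) : ClosedAt R o a₁ a₂ b E ends a₃ :=
  closedAt_of_b_move hl ho h1 h2 hl.ne
    (fun p hp => fourForms_of_markAnchor o a₁ a₂ a₃ _ _ p hp a₃ (Or.inr (Or.inr (Or.inr rfl))))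

/-- **Every special vertex pendant at the statement vertex closes it**: `z ∈ {o, a₁, a₂, b}` a leaf
at `a₃`, the four marks pairwise distinct. -/
theorem closedAt_of_special_leaf_at_a3 {z : V} (hz : z = o ∨ z = a₁ ∨ z = a₂ ∨ z = b)
    (hl : IsLeafAt ends a₃ z e₀)
    (hdist : o ≠ a₁ ∧ o ≠ a₂ ∧ o ≠ b ∧ a₁ ≠ a₂ ∧ a₁ ≠ b ∧ a₂ ≠ b) :
    ClosedAt R o a₁ a₂ b E ends a₃ := by
  obtain ⟨ho1, ho2, hob, h12, h1b, h2b⟩ := hdist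
  rcases hz with rfl | rfl | rfl | rfl
  · exact closedAt_of_o_leaf_at_a3 hl ho1.symm ho2.symm hob.symm
  · exact closedAt_of_a1_leaf_at_a3 hl h12.symm ho1 h1b.symm
  · exact closedAt_of_a2_leaf_at_a3 hl h12 ho2 h2b.symm
  · exact closedAt_of_b_leaf_at_a3 hl hob h1b h2b

end PendantSpecial

end CaseOne

end Summit.Ventures.PercRepro2
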